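import Summits.QuantumFields.BalabanUV.Beta.GAN24.FibreSymbolShiftCosh

/-!
# `BalabanUV.Beta.GAN24.FibreSymbolShiftCoercive` — binder row G-an2-4 / (CONV-C), propagator slot, road P1-fibre, typer row **P1-Y10c** (DAG node N15c), PART 3:
# the weighted shifted symbol in `EuclideanSpace ℂ n` currency (that of `SaddlePointBound.matrix_apriori` / row P1-Y10p `SaddlePointPerturbation`):
# Schur operator bound `ε_H = (e^Θ − 1)ρ` for `D_f F(q+iηa) D_{−f} − F(q)`, form defect `δ = (cosh Θ − 1)ρ`, the COERCIVITY TRANSFER, the stencil instance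
# (PART 1 = `GAN24/FibreSymbolShift`, PART 2 = `GAN24/FibreSymbolShiftCosh`)

NOT IN PRINT; OUR PROOF ATTEMPT.  HONEST FRAMING (cell contract, verbatim): «discharging `BetaPertH` makes Bałaban's UV stability
UNCONDITIONAL — a real constructive-QFT result; it is NOT the continuum limit and NOT the Clay problem.»  HONEST DEPENDENCY (verbatim):
«continuum YM on T⁴ ⇐ BetaPertH ∧ nine spine estimates (0/9 proved); BetaPertH ⇐ (D1) ∧ (D4) ∧ CAP+tail; G-an2-4 gates asym, D1 and
NE2/3/4.»  [folklore] finite algebra over `FibreInverseDecay.trigPolySymbol S L`, general finite index type `n`, general `(S, L)`, general intra-block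
weight `f : n → ℝ`; 0 `def`.  Cites nothing, mints no fact (every hypothesis is a displayed binder), instantiates NO wall binder, proves NO `j`-uniform
estimate: the support range `Θ`, the Schur bound `ρ` and the coercivity `γ` are HYPOTHESES whose `j`-uniform values are the L10 owner's content.
NOT BetaPertH, NOT continuum, NOT Clay.  (Unit b2b-balaban-gan24-formalise-leaf-01-g5; row P1-Y10c of `HOME/GAN24/Formal/LEAVES.md` v2.4 as amended 00:03:51Z.)

## What is proved (`F := trigPolySymbol S L`, `Fw := wConj f (F(q+iηa)) = D_f F(q+iηa) D_{−f}`, `E := Fw − F(q)`, real `q`, real `η`)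
§8  SCHUR OPERATOR BOUND (generic): row and column sums of `‖M i j‖` at most `ρ` ⇒ `‖toEuclideanLin M v‖ ≤ ρ‖v‖` (`norm_toEuclideanLin_le_of_schur`).
§9  THE `ε_H` INPUT: entries `E i j = Σ_b (e^{f i − f j − η a·b} − 1) cphase b q · L b i j`; under the support range `hΘ : L b i j ≠ 0 → |f i − f j − η a·b| ≤ Θ`
    and the Schur bounds `hrow/hcol : Σ Σ_b ‖L b i j‖ ≤ ρ`: `‖E i j‖ ≤ (e^Θ − 1) Σ_b ‖L b i j‖` and `‖toEuclideanLin E v‖ ≤ (e^Θ − 1)·ρ·‖v‖`.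
§10 THE `δ` INPUT AND THE COERCIVITY TRANSFER under `hS : b ∈ S → −b ∈ S`, `hL : L(−b) = (L b)ᴴ`: `⟪v, toEuclideanLin M v⟫ = star v ⬝ᵥ M v`,
    `−(cosh Θ − 1)ρ‖v‖² ≤ re ⟪v, toEuclideanLin E v⟫` (`re_inner_defect_ge`, the `hE` shape of `SaddlePointPerturbation`), and
    `coercive_wConj_imShift`: `re ⟪v, F(q) v⟫ ≥ γ‖v‖²` on a test class `P` (e.g. `ker B`) ⇒ `re ⟪v, Fw v⟫ ≥ (γ − (cosh Θ − 1)ρ)‖v‖²` on `P`;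
    the block-constant case `f = 0`: `coercive_imShift` with `Θ = |η|R` from the displacement range `|a·b| ≤ R`.
§11 (d) THE STENCIL INSTANCE: `neg_mem_stencil` (= (hS) for `trigPolySymbol (stencil (d+1)) pieceMatrix`), `sum_abs_le_of_mem_stencil` (`Σ_μ |b_μ| ≤ 3(d+1)`),
    `abs_rdot_le_of_mem_stencil` (`|a·b| ≤ 3(d+1)κ` for `|a_μ| ≤ κ`).  (hL) is NOT discharged for `BlochFibreMatrix.pieceMatrix` (the typed EL/G/M/Q system is not
    literally Hermitian — G rows are gauge-quantity differences, the M row a block sum): hypothesis for the L10 owner, as the row allows.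
-/

noncomputable section

open Complex Finset Matrix WithLp
open scoped BigOperators InnerProductSpace ComplexConjugate
open Literature.MathematicalPhysics.QuantumFieldTheory
open Literature.MathematicalPhysics.QuantumFieldTheory.Balaban1983to89
open Literature.MathematicalPhysics.QuantumFieldTheory.Balaban1983to89.Beta
open B4Strip (ofRealVec Strip)
open FibreInverseDecay (cphase trigPolySymbol trigPolySymbol_apply)
open BlochFibreMatrix (stencil mem_stencil)
open Summit.QuantumFields.BalabanUV.Beta.GAN24.FibreStepResidues (norm_cphase_ofRealVec)
open Summit.QuantumFields.BalabanUV.Beta.GAN24.FibreSymbolShift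
open Summit.QuantumFields.BalabanUV.Beta.GAN24.FibreSymbolShiftCosh

namespace Summit.QuantumFields.BalabanUV.Beta.GAN24.FibreSymbolShiftCoercive

variable {d : ℕ} {n : Type*} [Fintype n] [DecidableEq n]

/-! ## §8 The Schur operator bound in `EuclideanSpace ℂ n` -/

omit [DecidableEq n] in
/-- [folklore] one row: `‖Σ_j M i j w j‖² ≤ (Σ_j ‖M i j‖) · Σ_j ‖M i j‖·‖w j‖²` (Cauchy–Schwarz with the weights `‖M i j‖`). -/
theorem norm_mulVec_apply_sq_le (M : Matrix n n ℂ) (w : n → ℂ) (i : n) :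
    ‖(M *ᵥ w) i‖ ^ 2 ≤ (∑ j, ‖M i j‖) * ∑ j, ‖M i j‖ * ‖w j‖ ^ 2 := by
  have h1 : ‖(M *ᵥ w) i‖ ≤ ∑ j, ‖M i j‖ * ‖w j‖ := by
    rw [Matrix.mulVec, dotProduct]
    exact (norm_sum_le _ _).trans (le_of_eq (Finset.sum_congr rfl fun j _ => norm_mul _ _))
  refine (pow_le_pow_left₀ (norm_nonneg _) h1 2).trans ?_
  exact Finset.sum_sq_le_sum_mul_sum_of_sq_le_mul _ (fun j _ => norm_nonneg _)
    (fun j _ => mul_nonneg (norm_nonneg _) (sq_nonneg _)) (fun j _ => le_of_eq (by ring))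

/-- [folklore] the squared form of the Schur test: `‖M v‖² ≤ ρ_row · ρ_col · ‖v‖²`. -/
theorem norm_toEuclideanLin_sq_le_of_schur {M : Matrix n n ℂ} {ρr ρc : ℝ} (hrow : ∀ i, ∑ j, ‖M i j‖ ≤ ρr)
    (hcol : ∀ j, ∑ i, ‖M i j‖ ≤ ρc) (hρr : 0 ≤ ρr) (v : EuclideanSpace ℂ n) :
    ‖toEuclideanLin M v‖ ^ 2 ≤ ρr * ρc * ‖v‖ ^ 2 := by
  rw [EuclideanSpace.norm_sq_eq, EuclideanSpace.norm_sq_eq, Finset.mul_sum]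
  calc ∑ i, ‖(toEuclideanLin M v) i‖ ^ 2 = ∑ i, ‖(M *ᵥ ofLp v) i‖ ^ 2 := by
        refine Finset.sum_congr rfl fun i _ => ?_
        rw [Matrix.toLpLin_apply]
    _ ≤ ∑ i, (∑ j, ‖M i j‖) * ∑ j, ‖M i j‖ * ‖(ofLp v) j‖ ^ 2 :=
        Finset.sum_le_sum fun i _ => norm_mulVec_apply_sq_le M (ofLp v) i
    _ ≤ ∑ i, ρr * ∑ j, ‖M i j‖ * ‖(ofLp v) j‖ ^ 2 :=
        Finset.sum_le_sum fun i _ => mul_le_mul_of_nonneg_right (hrow i)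
          (Finset.sum_nonneg fun j _ => mul_nonneg (norm_nonneg _) (sq_nonneg _))
    _ = ∑ j, ρr * ((∑ i, ‖M i j‖) * ‖(ofLp v) j‖ ^ 2) := by
        rw [← Finset.mul_sum, ← Finset.mul_sum, Finset.sum_comm]
        congr 1
        exact Finset.sum_congr rfl fun j _ => by rw [Finset.sum_mul]
    _ ≤ ∑ j, ρr * ρc * ‖v j‖ ^ 2 := Finset.sum_le_sum fun j _ => by
        rw [mul_assoc]
        exact mul_le_mul_of_nonneg_left (mul_le_mul_of_nonneg_right (hcol j) (sq_nonneg _)) hρr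

/-- [folklore] **THE SCHUR TEST, operator form**: if the row sums and the column sums of `‖M i j‖` are `≤ ρ`, then `‖M v‖ ≤ ρ‖v‖` in `EuclideanSpace ℂ n`. -/
theorem norm_toEuclideanLin_le_of_schur {M : Matrix n n ℂ} {ρ : ℝ} (hrow : ∀ i, ∑ j, ‖M i j‖ ≤ ρ) (hcol : ∀ j, ∑ i, ‖M i j‖ ≤ ρ)
    (v : EuclideanSpace ℂ n) : ‖toEuclideanLin M v‖ ≤ ρ * ‖v‖ := by
  by_cases hn : Nonempty n
  · obtain ⟨i⟩ := hn
    have hρ : 0 ≤ ρ := (Finset.sum_nonneg fun j _ => norm_nonneg _).trans (hrow i)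
    have hsq : ‖toEuclideanLin M v‖ ^ 2 ≤ (ρ * ‖v‖) ^ 2 := by
      rw [mul_pow, sq ρ]
      exact norm_toEuclideanLin_sq_le_of_schur hrow hcol hρ v
    exact le_of_pow_le_pow_left₀ two_ne_zero (mul_nonneg hρ (norm_nonneg v)) hsq
  · have he : (Finset.univ : Finset n) = ∅ := Finset.univ_eq_empty_iff.mpr (not_nonempty_iff.mp hn)
    have h0 : ∀ w : EuclideanSpace ℂ n, ‖w‖ = 0 := fun w => by
      rw [EuclideanSpace.norm_eq, he, Finset.sum_empty, Real.sqrt_zero]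
    rw [h0, h0, mul_zero]

/-! ## §9 The `ε_H` input: entries and operator bound of `E = D_f F(q+iηa) D_{−f} − F(q)` -/

variable (S : Finset (Fin (d + 1) → ℤ)) (L : (Fin (d + 1) → ℤ) → Matrix n n ℂ)

/-- [folklore] entries of the weighted difference: `E i j = Σ_{b∈S} (e^{f i − f j − η a·b} − 1) · cphase b p · L b i j`. -/
theorem wConj_imShift_sub_apply (f : n → ℝ) (p : Fin (d + 1) → ℂ) (η : ℝ) (a : Fin (d + 1) → ℝ) (i j : n) :
    (wConj f (trigPolySymbol S L (imShift p η a)) - trigPolySymbol S L p) i j =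
      ∑ b ∈ S, ((Real.exp (f i - f j - η * rdot a b) - 1 : ℝ) : ℂ) * cphase b p * L b i j := by
  rw [Matrix.sub_apply, wConj_trigPolySymbol_imShift_apply, trigPolySymbol_apply, ← Finset.sum_sub_distrib]
  refine Finset.sum_congr rfl fun b _ => ?_
  push_cast
  ring

/-- [folklore] **ENTRY BOUND of the weighted difference** at real momentum under the support range `hΘ`:
`‖E i j‖ ≤ (e^Θ − 1) · Σ_{b∈S} ‖L b i j‖`. -/
theorem norm_wConj_imShift_sub_apply_le (f : n → ℝ) (q : Fin (d + 1) → ℝ) (η : ℝ) (a : Fin (d + 1) → ℝ) {Θ : ℝ}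
    (hΘ : ∀ b ∈ S, ∀ i j, L b i j ≠ 0 → |f i - f j - η * rdot a b| ≤ Θ) (i j : n) :
    ‖(wConj f (trigPolySymbol S L (imShift (ofRealVec q) η a)) - trigPolySymbol S L (ofRealVec q)) i j‖ ≤
      (Real.exp Θ - 1) * ∑ b ∈ S, ‖L b i j‖ := by
  rw [wConj_imShift_sub_apply, Finset.mul_sum]
  refine (norm_sum_le _ _).trans (Finset.sum_le_sum fun b hb => ?_)
  rw [norm_mul, norm_mul, norm_cphase_ofRealVec, mul_one, Complex.norm_real, Real.norm_eq_abs]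
  by_cases h0 : L b i j = 0
  · simp [h0]
  · exact mul_le_mul_of_nonneg_right (abs_exp_taylor_le (hΘ b hb i j h0)).1 (norm_nonneg _)

variable {S L}

/-- [folklore] **THE `ε_H` INPUT (operator bound of the weighted difference)**: under `0 ≤ Θ`, the support range `hΘ` and the Schur bounds `hrow`, `hcol`
(row/column sums of `Σ_b ‖L b i j‖` at most `ρ`), `‖toEuclideanLin (D_f F(q+iηa) D_{−f} − F(q)) v‖ ≤ (e^Θ − 1)·ρ·‖v‖`. -/
theorem norm_toEuclideanLin_wConj_imShift_sub_le (f : n → ℝ) (q : Fin (d + 1) → ℝ) (η : ℝ) (a : Fin (d + 1) → ℝ) {Θ ρ : ℝ}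
    (hΘ0 : 0 ≤ Θ) (hΘ : ∀ b ∈ S, ∀ i j, L b i j ≠ 0 → |f i - f j - η * rdot a b| ≤ Θ)
    (hrow : ∀ i, ∑ j, ∑ b ∈ S, ‖L b i j‖ ≤ ρ) (hcol : ∀ j, ∑ i, ∑ b ∈ S, ‖L b i j‖ ≤ ρ) (v : EuclideanSpace ℂ n) :
    ‖toEuclideanLin (wConj f (trigPolySymbol S L (imShift (ofRealVec q) η a)) - trigPolySymbol S L (ofRealVec q)) v‖ ≤
      (Real.exp Θ - 1) * ρ * ‖v‖ := by
  have hE : 0 ≤ Real.exp Θ - 1 := sub_nonneg.mpr (Real.one_le_exp hΘ0)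
  refine norm_toEuclideanLin_le_of_schur (fun i => ?_) (fun j => ?_) v
  · calc ∑ j, ‖(wConj f (trigPolySymbol S L (imShift (ofRealVec q) η a)) - trigPolySymbol S L (ofRealVec q)) i j‖
        ≤ ∑ j, (Real.exp Θ - 1) * ∑ b ∈ S, ‖L b i j‖ :=
          Finset.sum_le_sum fun j _ => norm_wConj_imShift_sub_apply_le S L f q η a hΘ i j
      _ ≤ (Real.exp Θ - 1) * ρ := by rw [← Finset.mul_sum]; exact mul_le_mul_of_nonneg_left (hrow i) hE
  · calc ∑ i, ‖(wConj f (trigPolySymbol S L (imShift (ofRealVec q) η a)) - trigPolySymbol S L (ofRealVec q)) i j‖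
        ≤ ∑ i, (Real.exp Θ - 1) * ∑ b ∈ S, ‖L b i j‖ :=
          Finset.sum_le_sum fun i _ => norm_wConj_imShift_sub_apply_le S L f q η a hΘ i j
      _ ≤ (Real.exp Θ - 1) * ρ := by rw [← Finset.mul_sum]; exact mul_le_mul_of_nonneg_left (hcol j) hE

/-! ## §10 The `δ` input and the coercivity transfer -/

/-- [folklore] the inner product against `toEuclideanLin M` is the form of PART 2: `⟪v, M v⟫ = star v ⬝ᵥ (M *ᵥ v)`. -/
theorem inner_toEuclideanLin_eq_form (M : Matrix n n ℂ) (v : EuclideanSpace ℂ n) :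
    ⟪v, toEuclideanLin M v⟫_ℂ = star (ofLp v) ⬝ᵥ (M *ᵥ ofLp v) := by
  rw [EuclideanSpace.inner_eq_star_dotProduct, Matrix.ofLp_toLpLin, Matrix.toLin'_apply, dotProduct_comm]

omit [DecidableEq n] in
/-- [folklore] `‖v‖² = Σ_i ‖v i‖²` in the `ofLp` spelling of PART 2's bounds. -/
theorem norm_sq_eq_sum (v : EuclideanSpace ℂ n) : ‖v‖ ^ 2 = ∑ i, ‖(ofLp v) i‖ ^ 2 := EuclideanSpace.norm_sq_eq v

/-- [folklore] **THE LOWER BOUND IN EUCLIDEAN CURRENCY**: under (hS) (hL), the support range `hΘ` and the Schur bounds,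
`re ⟪v, F(q) v⟫ − (cosh Θ − 1)·ρ·‖v‖² ≤ re ⟪v, D_f F(q+iηa) D_{−f} v⟫`. -/
theorem re_inner_wConj_imShift_ge (hS : ∀ b ∈ S, -b ∈ S) (hL : ∀ b ∈ S, L (-b) = (L b)ᴴ) (f : n → ℝ) (q : Fin (d + 1) → ℝ)
    (η : ℝ) (a : Fin (d + 1) → ℝ) {Θ ρ : ℝ} (hΘ : ∀ b ∈ S, ∀ i j, L b i j ≠ 0 → |f i - f j - η * rdot a b| ≤ Θ)
    (hrow : ∀ i, ∑ j, ∑ b ∈ S, ‖L b i j‖ ≤ ρ) (hcol : ∀ j, ∑ i, ∑ b ∈ S, ‖L b i j‖ ≤ ρ) (v : EuclideanSpace ℂ n) :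
    re ⟪v, toEuclideanLin (trigPolySymbol S L (ofRealVec q)) v⟫_ℂ - (Real.cosh Θ - 1) * ρ * ‖v‖ ^ 2 ≤
      re ⟪v, toEuclideanLin (wConj f (trigPolySymbol S L (imShift (ofRealVec q) η a))) v⟫_ℂ := by
  rw [inner_toEuclideanLin_eq_form, inner_toEuclideanLin_eq_form, norm_sq_eq_sum]
  exact re_form_wConj_imShift_ge hS hL f q η a hΘ hrow hcol (ofLp v)

/-- [folklore] **THE `δ` INPUT** (the `hE`/`hcoer`-perturbation shape of row P1-Y10p `SaddlePointPerturbation`): under (hS) (hL), `hΘ`, `hrow`, `hcol`,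
`−(cosh Θ − 1)·ρ·‖v‖² ≤ re ⟪v, (D_f F(q+iηa) D_{−f} − F(q)) v⟫` for EVERY `v` — the anti-Hermitian first order costs nothing. -/
theorem re_inner_defect_ge (hS : ∀ b ∈ S, -b ∈ S) (hL : ∀ b ∈ S, L (-b) = (L b)ᴴ) (f : n → ℝ) (q : Fin (d + 1) → ℝ)
    (η : ℝ) (a : Fin (d + 1) → ℝ) {Θ ρ : ℝ} (hΘ : ∀ b ∈ S, ∀ i j, L b i j ≠ 0 → |f i - f j - η * rdot a b| ≤ Θ)
    (hrow : ∀ i, ∑ j, ∑ b ∈ S, ‖L b i j‖ ≤ ρ) (hcol : ∀ j, ∑ i, ∑ b ∈ S, ‖L b i j‖ ≤ ρ) (v : EuclideanSpace ℂ n) :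
    -((Real.cosh Θ - 1) * ρ) * ‖v‖ ^ 2 ≤
      re ⟪v, toEuclideanLin (wConj f (trigPolySymbol S L (imShift (ofRealVec q) η a)) - trigPolySymbol S L (ofRealVec q)) v⟫_ℂ := by
  have h := re_inner_wConj_imShift_ge hS hL f q η a hΘ hrow hcol v
  rw [map_sub, LinearMap.sub_apply, inner_sub_right, Complex.sub_re]
  linarith

/-- [folklore] **COERCIVITY TRANSFER WITH INTRA-BLOCK WEIGHT** (the `hcoer` currency of `SaddlePointBound.matrix_test_vector_of_coercive`):
if `re ⟪v, F(q) v⟫ ≥ γ‖v‖²` on a test class `P` (e.g. `ker B`), then under (hS) (hL), `hΘ`, `hrow`, `hcol`,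
`re ⟪v, D_f F(q+iηa) D_{−f} v⟫ ≥ (γ − (cosh Θ − 1)·ρ)‖v‖²` on the same class — second order in `Θ`, no first-order loss. -/
theorem coercive_wConj_imShift (hS : ∀ b ∈ S, -b ∈ S) (hL : ∀ b ∈ S, L (-b) = (L b)ᴴ) (f : n → ℝ) (q : Fin (d + 1) → ℝ)
    (η : ℝ) (a : Fin (d + 1) → ℝ) {Θ ρ : ℝ} (hΘ : ∀ b ∈ S, ∀ i j, L b i j ≠ 0 → |f i - f j - η * rdot a b| ≤ Θ)
    (hrow : ∀ i, ∑ j, ∑ b ∈ S, ‖L b i j‖ ≤ ρ) (hcol : ∀ j, ∑ i, ∑ b ∈ S, ‖L b i j‖ ≤ ρ)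
    {P : EuclideanSpace ℂ n → Prop} {γ : ℝ}
    (hcoer : ∀ v, P v → γ * ‖v‖ ^ 2 ≤ re ⟪v, toEuclideanLin (trigPolySymbol S L (ofRealVec q)) v⟫_ℂ) :
    ∀ v, P v → (γ - (Real.cosh Θ - 1) * ρ) * ‖v‖ ^ 2 ≤
      re ⟪v, toEuclideanLin (wConj f (trigPolySymbol S L (imShift (ofRealVec q) η a))) v⟫_ℂ := by
  intro v hv
  have h1 := hcoer v hv
  have h2 := re_inner_wConj_imShift_ge hS hL f q η a hΘ hrow hcol v
  rw [sub_mul]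
  linarith

/-- [folklore] **COERCIVITY TRANSFER, block-constant weight (`f = 0`)**: with the displacement range `|a·b| ≤ R` on `S` (so `Θ = |η|R`),
`re ⟪v, F(q+iηa) v⟫ ≥ (γ − (cosh(|η|R) − 1)·ρ)‖v‖²` on the test class. -/
theorem coercive_imShift (hS : ∀ b ∈ S, -b ∈ S) (hL : ∀ b ∈ S, L (-b) = (L b)ᴴ) (q : Fin (d + 1) → ℝ) (η : ℝ)
    {a : Fin (d + 1) → ℝ} {R ρ : ℝ} (hR : ∀ b ∈ S, |rdot a b| ≤ R)
    (hrow : ∀ i, ∑ j, ∑ b ∈ S, ‖L b i j‖ ≤ ρ) (hcol : ∀ j, ∑ i, ∑ b ∈ S, ‖L b i j‖ ≤ ρ)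
    {P : EuclideanSpace ℂ n → Prop} {γ : ℝ}
    (hcoer : ∀ v, P v → γ * ‖v‖ ^ 2 ≤ re ⟪v, toEuclideanLin (trigPolySymbol S L (ofRealVec q)) v⟫_ℂ) :
    ∀ v, P v → (γ - (Real.cosh (|η| * R) - 1) * ρ) * ‖v‖ ^ 2 ≤
      re ⟪v, toEuclideanLin (trigPolySymbol S L (imShift (ofRealVec q) η a)) v⟫_ℂ := by
  have h := coercive_wConj_imShift hS hL 0 q η a (theta_zero_of_range (L := L) hR η) hrow hcol hcoer
  rw [wConj_zero] at h
  exact h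

/-! ## §11 (d) The stencil instance: symmetry and range of `BlochFibreMatrix.stencil` -/

/-- [folklore] **(d) the stencil is negation symmetric**: `b ∈ stencil (d+1) → −b ∈ stencil (d+1)` — hypothesis (hS) for the KKT fibre symbol
`trigPolySymbol (stencil (d+1)) pieceMatrix` of `BlochFibreMatrix.fibreMatrix_blochChar_eq_trigPolySymbol`. -/
theorem neg_mem_stencil {b : Fin (d + 1) → ℤ} (hb : b ∈ stencil (d + 1)) : -b ∈ stencil (d + 1) := by
  rw [mem_stencil] at hb ⊢
  intro j
  have := hb j
  simp only [Pi.neg_apply]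
  omega

/-- [folklore] (d) the `ℓ¹` size of a stencil displacement: `Σ_μ |b_μ| ≤ 3(d+1)`. -/
theorem sum_abs_le_of_mem_stencil {b : Fin (d + 1) → ℤ} (hb : b ∈ stencil (d + 1)) : ∑ μ, |(b μ : ℝ)| ≤ 3 * (d + 1) := by
  rw [mem_stencil] at hb
  have h : ∀ μ, |(b μ : ℝ)| ≤ 3 := fun μ => by
    rw [← Int.cast_abs]
    have := hb μ
    have h3 : |b μ| ≤ 3 := abs_le.mpr ⟨this.1, this.2⟩
    exact_mod_cast h3
  calc ∑ μ, |(b μ : ℝ)| ≤ ∑ _μ : Fin (d + 1), (3 : ℝ) := Finset.sum_le_sum fun μ _ => h μ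
    _ = 3 * (d + 1) := by rw [Finset.sum_const, Finset.card_univ, Fintype.card_fin, nsmul_eq_mul]; push_cast; ring

/-- [folklore] **(d) THE RANGE OF THE STENCIL**: for a direction with `|a_μ| ≤ κ`, `0 ≤ κ`, every stencil displacement has `|a·b| ≤ 3(d+1)κ` — the `R` of
PART 1 §3 and of `coercive_imShift` for the KKT fibre symbol. -/
theorem abs_rdot_le_of_mem_stencil (a : Fin (d + 1) → ℝ) {κ : ℝ} (ha : ∀ μ, |a μ| ≤ κ) (hκ : 0 ≤ κ) {b : Fin (d + 1) → ℤ}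
    (hb : b ∈ stencil (d + 1)) : |rdot a b| ≤ 3 * (d + 1) * κ := by
  refine (abs_rdot_le a b ha).trans ?_
  rw [mul_comm (3 * ((d : ℝ) + 1)) κ]
  exact mul_le_mul_of_nonneg_left (sum_abs_le_of_mem_stencil hb) hκ

/-! ## §12 Block bridges (XREAD INFO D1 of leaf-08-g5, 00:35:27Z): principal submatrices of the symbol, of (hL) and of the weighted conjugation -/

section Blocks

variable {m : Type*} [Fintype m] [DecidableEq m]

omit [Fintype n] [DecidableEq n] [Fintype m] [DecidableEq m] in
/-- [folklore] a principal reindexing of a trigonometric-polynomial symbol is the symbol of the reindexed coefficients: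
`(F(p)).submatrix r r = trigPolySymbol S (b ↦ (L b).submatrix r r) p` (e.g. `r = Sum.inl` = the field block of the KKT symbol). -/
theorem submatrix_trigPolySymbol (r : m → n) (p : Fin (d + 1) → ℂ) :
    (trigPolySymbol S L p).submatrix r r = trigPolySymbol S (fun b => (L b).submatrix r r) p := by
  ext i j
  simp only [Matrix.submatrix_apply, trigPolySymbol_apply]

omit [Fintype n] [DecidableEq n] [Fintype m] [DecidableEq m] in
/-- [folklore] (hL) descends to principal blocks: `(L(−b)).submatrix r r = ((L b).submatrix r r)ᴴ`. -/
theorem submatrix_hL (r : m → n) (hL : ∀ b ∈ S, L (-b) = (L b)ᴴ) :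
    ∀ b ∈ S, (fun b => (L b).submatrix r r) (-b) = ((fun b => (L b).submatrix r r) b)ᴴ := by
  intro b hb
  simp only [hL b hb, Matrix.conjTranspose_submatrix]

/-- [folklore] the weighted conjugation commutes with principal reindexing: `(D_f M D_{−f}).submatrix r r = D_{f∘r} (M.submatrix r r) D_{−f∘r}`. -/
theorem submatrix_wConj (f : n → ℝ) (M : Matrix n n ℂ) (r : m → n) :
    (wConj f M).submatrix r r = wConj (f ∘ r) (M.submatrix r r) := by
  ext i j
  simp only [Matrix.submatrix_apply, wConj_apply, Function.comp_apply]

/-- [folklore] hence the principal block of the weighted shifted symbol is the weighted shifted symbol of the block coefficients — every statement of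
PARTS 2–3 applies VERBATIM to a principal block (field block `r = Sum.inl`, …) with `(S, L ∘ submatrix)`, weight `f ∘ r`, and (hS), `submatrix_hL`. -/
theorem submatrix_wConj_trigPolySymbol_imShift (f : n → ℝ) (r : m → n) (p : Fin (d + 1) → ℂ) (η : ℝ) (a : Fin (d + 1) → ℝ) :
    (wConj f (trigPolySymbol S L (imShift p η a))).submatrix r r =
      wConj (f ∘ r) (trigPolySymbol S (fun b => (L b).submatrix r r) (imShift p η a)) := by
  rw [submatrix_wConj, submatrix_trigPolySymbol]

end Blocks

end Summit.QuantumFields.BalabanUV.Beta.GAN24.FibreSymbolShiftCoercive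

end
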